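import Literature.NumberTheory.Sieve.FordMaynardFragOpMeasure
import Literature.NumberTheory.Sieve.FordMaynardFragmentationProofs
import Literature.NumberTheory.Sieve.FordMaynardFragmentationPLProofs
import HarnessLib

/-!
# Ford–Maynard, Theorem 9.1: the tweaked function `f̃`/`h` and its properties

Analytic half of Theorem 9.1 / Theorem 6.3 (a) of K. Ford, J. Maynard, *On the theory of prime
producing sieves* (arXiv:2407.14368), §§6.2, 9. Everything here is PROVED. Given `f ∈ 𝔉*_η(γ)`
and finitely many short intervals `[lo_l, lo_l + w_l]`, let `Bad(ξ)` mean that `ξ` has a nonempty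
proper subsum in one of them (`BadSubsum`). Following the printed proofs (first (ftilde): cut `f` to
`𝒟_{k,η}(P)`, then (fsl); and the tweak `h` of §6.2), we set

* `tweakData lo w f = f · 𝟙[¬ Bad]` (the values kept on vectors with all entries `< 1 − γ`),
* `tweak γ η lo w f (ξ) = 𝟙[ξᵢ ≥ η, |ξ| = 1] · fragOp γ η (tweakData lo w f) (ξ)` (re-extension by
  the fragmentation relation (6.3)),

and prove that `h = tweak γ η lo w f` has every property required by the arithmetic half
(`primeFreeAdmissible_of_vecFn` of `FordMaynardConstruction.lean`): `h ∈ 𝒮`; support in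
`{ξᵢ ≥ η, |ξ| = 1}`; piecewise Lipschitz in each dimension (hence bounded and measurable);
(TypeI-f) with parameter `γ` (Theorem 6.4: `h` satisfies the fragmentation relation by
construction); `h = 0` at vectors with a bad subsum (fragmentation creates no new proper subsums
of `ξ`... rather: a bad proper subsum of `ξ` is a bad proper subsum of every fragmentation); and
the quantitative closeness `|h(ξ) − f(ξ)| ≤ C(m, η) sup|f| ∑ w_l` at good `ξ` ((fh1), (f-ftilde)).

## References

* K. Ford, J. Maynard, *On the theory of prime producing sieves*, arXiv:2407.14368v1 (2024), §6.2
  (proof of Theorem 6.3 (a): the tweak `h`, (fh1)) and §9 (proof of Theorem 9.1: (ftilde),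
  (fbetalower), (fone), (f-ftilde)). [FordMaynard2024PrimeSieves]
-/

noncomputable section

open MeasureTheory Finset

namespace Literature.NumberTheory.Sieve.FordMaynard

/-! ### Piecewise Lipschitz functions times `PolyLip` functions -/

/-- The product of a piecewise Lipschitz function (bounded polyhedral pieces) with a `PolyLip`
function is piecewise Lipschitz. [folklore] -/
theorem IsPiecewiseLipschitz'.mul_polyLip {E : Type*} [NormedAddCommGroup E] [NormedSpace ℝ E]
    {g q : E → ℝ} (hg : IsPiecewiseLipschitz' g) (hq : PolyLip q) :
    IsPiecewiseLipschitz' (fun x => g x * q x) := by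
  classical
  obtain ⟨ι, hι, P, h, hP, hgsum⟩ := hg
  obtain ⟨ι', hι', Q, L, hQ, hqsum⟩ := hq
  refine ⟨ι × ι', inferInstance, fun p => P p.1 ∩ Q p.2,
    fun p x => (Q p.2).indicator (L p.2) x * h p.1 x, fun p => ⟨(hP p.1).1.inter (hQ p.2).1,
      (hP p.1).2.1.subset Set.inter_subset_left, fun x hx => ?_, ?_⟩, fun x => ?_⟩
  · show (Q p.2).indicator (L p.2) x * h p.1 x = 0
    by_cases hx1 : x ∈ P p.1
    · rw [Set.indicator_of_notMem (fun hx2 => hx ⟨hx1, hx2⟩), zero_mul]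
    · rw [(hP p.1).2.2.1 x hx1, mul_zero]
  · obtain ⟨K, hK⟩ := (hP p.1).2.2.2
    obtain ⟨K', hK'⟩ := (hQ p.2).2.1
    obtain ⟨M, hM⟩ := exists_abs_le_of_lipschitzOnWith hK (hP p.1).2.1
    obtain ⟨M', hM'⟩ := (hQ p.2).2.2
    have hind : LipschitzOnWith K' ((Q p.2).indicator (L p.2)) (P p.1 ∩ Q p.2) := by
      intro x hx y hy
      rw [Set.indicator_of_mem hx.2, Set.indicator_of_mem hy.2]
      exact hK' hx.2 hy.2
    have hMind : ∀ x ∈ P p.1 ∩ Q p.2, |(Q p.2).indicator (L p.2) x| ≤ M' := fun x hx => by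
      rw [Set.indicator_of_mem hx.2]; exact hM' x hx.2
    exact ⟨_, lipschitzOnWith_mul_of_bounded hind (hK.mono Set.inter_subset_left) hMind
      fun x hx => hM x hx.1⟩
  · show g x * q x = ∑ p : ι × ι', (Q p.2).indicator (L p.2) x * h p.1 x
    rw [hgsum x, hqsum x, Finset.sum_mul, Fintype.sum_prod_type]
    refine Finset.sum_congr rfl fun i _ => ?_
    rw [Finset.mul_sum]
    refine Finset.sum_congr rfl fun t _ => by ring

/-- A bound for a piecewise Lipschitz function on `ℝ^k`. [folklore] -/
theorem IsPiecewiseLipschitz.exists_bound {k : ℕ} {g : (Fin k → ℝ) → ℝ} (hg : IsPiecewiseLipschitz g) :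
    ∃ M : ℝ, 0 ≤ M ∧ ∀ x, |g x| ≤ M := by
  classical
  obtain ⟨n, P, h, hP, hsum⟩ := hg
  have hb : ∀ j, ∃ M, 0 ≤ M ∧ ∀ x, |h j x| ≤ M := by
    intro j
    obtain ⟨K, hK⟩ := (hP j).2.2
    obtain ⟨M, hM⟩ := exists_abs_le_of_lipschitzOnWith hK (hP j).1.1
    refine ⟨max M 0, le_max_right _ _, fun x => ?_⟩
    by_cases hx : x ∈ P j
    · exact (hM x hx).trans (le_max_left _ _)
    · rw [(hP j).2.1 x hx, abs_zero]; exact le_max_right _ _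
  choose M hM0 hM using hb
  refine ⟨∑ j, M j, Finset.sum_nonneg fun j _ => hM0 j, fun x => ?_⟩
  rw [hsum x]
  exact (Finset.abs_sum_le_sum_abs _ _).trans (Finset.sum_le_sum fun j _ => hM j x)

/-! ### Bad subsums: symmetry, transfer along coagulations, polyhedrality -/

/-- `BadSubsum` is invariant under permutations of the coordinates. [folklore] -/
theorem badSubsum_comp_perm {L : ℕ} (lo wd : Fin L → ℝ) {k : ℕ} (σ : Equiv.Perm (Fin k)) (ξ : Fin k → ℝ) :
    BadSubsum lo wd k (ξ ∘ σ) ↔ BadSubsum lo wd k ξ := by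
  classical
  have key : ∀ (τ : Equiv.Perm (Fin k)) (v : Fin k → ℝ), BadSubsum lo wd k (v ∘ τ) → BadSubsum lo wd k v := by
    intro τ v ⟨A, hAne, hAuniv, l, h1, h2⟩
    have hsum : ∑ t ∈ A, (v ∘ τ) t = ∑ t ∈ A.map τ.toEmbedding, v t := by
      rw [Finset.sum_map]; rfl
    refine ⟨A.map τ.toEmbedding, by simpa using hAne, ?_, l, by rwa [← hsum], by rwa [← hsum]⟩
    intro h
    apply hAuniv
    apply Finset.eq_univ_of_card
    have := congrArg Finset.card h
    rwa [Finset.card_map, Finset.card_univ] at this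
  refine ⟨key σ ξ, fun h => key σ.symm (ξ ∘ σ) ?_⟩
  have : (ξ ∘ σ) ∘ σ.symm = ξ := by funext t; simp
  rwa [this]

/-- **A bad proper subsum of a coagulation is a bad proper subsum of the finer vector.**
[cite: FordMaynard2024PrimeSieves, §6.2 ("If (β,α) has a subsum in 𝓘_ε then clearly (β,u₁,…,u_ℓ) does also")] -/
theorem IsCoagulationOf.badSubsum {L : ℕ} {lo wd : Fin L → ℝ} {n k : ℕ} {x : Fin n → ℝ} {y : Fin k → ℝ}
    (h : IsCoagulationOf x y) (hy : BadSubsum lo wd k y) : BadSubsum lo wd n x := by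
  classical
  obtain ⟨B, hBne, hBuniv, l, h1, h2⟩ := hy
  by_contra hx
  have hxno : NoProperSubsumIn (lo l) (wd l) x := by
    intro A hAne hAuniv
    by_contra hcon
    push Not at hcon
    exact hx ⟨A, hAne, hAuniv, l, hcon.1, hcon.2⟩
  rcases h.noProperSubsumIn hxno B hBne hBuniv with h' | h' <;> linarith

/-- The set of vectors whose subsum over `A` lies in `[a, a + b]` is polyhedral. [folklore] -/
theorem isPolyhedral_subsum_mem {k : ℕ} (A : Finset (Fin k)) (a b : ℝ) :
    IsPolyhedral {ξ : Fin k → ℝ | a ≤ ∑ t ∈ A, ξ t ∧ ∑ t ∈ A, ξ t ≤ a + b} := by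
  set φ : (Fin k → ℝ) →ₗ[ℝ] ℝ := ∑ t ∈ A, LinearMap.proj t with hφ
  have hφapp : ∀ ξ : Fin k → ℝ, φ ξ = ∑ t ∈ A, ξ t := fun ξ => by
    rw [hφ, LinearMap.sum_apply]; rfl
  have h1 : IsPolyhedral {ξ : Fin k → ℝ | a ≤ φ ξ} := isPolyhedral_ge φ a
  have h2 : IsPolyhedral {ξ : Fin k → ℝ | φ ξ ≤ a + b} := isPolyhedral_le φ (a + b)
  convert h1.inter h2 using 1
  ext ξ; simp [hφapp]

open scoped Classical in
/-- **The indicator of "no bad subsum" is `PolyLip`**: it is the finite product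
`∏_{(A,l)} (1 − 𝟙[∑_A ξ ∈ [lo_l, lo_l + w_l]])`. [cite: FordMaynard2024PrimeSieves, §9 ("𝒟_{k,η}(P) is a finite union of convex polytopes")] -/
theorem polyLip_notBad_indicator {L : ℕ} (lo wd : Fin L → ℝ) (k : ℕ) :
    PolyLip (fun ξ : Fin k → ℝ => if BadSubsum lo wd k ξ then (0 : ℝ) else 1) := by
  classical
  set T : Finset (Finset (Fin k) × Fin L) :=
    ((Finset.univ : Finset (Finset (Fin k))).filter (fun A => A.Nonempty ∧ A ≠ Finset.univ)) ×ˢ Finset.univ with hT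
  set B : Finset (Fin k) × Fin L → Set (Fin k → ℝ) := fun p =>
    {ξ | lo p.2 ≤ ∑ t ∈ p.1, ξ t ∧ ∑ t ∈ p.1, ξ t ≤ lo p.2 + wd p.2} with hB
  have hprod : PolyLip (fun ξ : Fin k → ℝ => ∏ p ∈ T, (1 + (-1) * (B p).indicator (fun _ => (1 : ℝ)) ξ)) :=
    PolyLip.finset_prod T fun p _ => (PolyLip.const 1).add ((PolyLip.indicator_one (isPolyhedral_subsum_mem p.1 _ _)).const_mul (-1))
  refine hprod.congr fun ξ => ?_
  by_cases hbad : BadSubsum lo wd k ξ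
  · rw [if_pos hbad]
    obtain ⟨A, hAne, hAuniv, l, h1, h2⟩ := hbad
    have hmem : (A, l) ∈ T := by
      rw [hT, Finset.mem_product, Finset.mem_filter]; exact ⟨⟨Finset.mem_univ _, hAne, hAuniv⟩, Finset.mem_univ _⟩
    refine Finset.prod_eq_zero hmem ?_
    rw [Set.indicator_of_mem (show ξ ∈ B (A, l) from ⟨h1, h2⟩)]; ring
  · rw [if_neg hbad]
    refine Finset.prod_eq_one fun p hp => ?_
    have hnot : ξ ∉ B p := by
      intro hξ
      rw [hT, Finset.mem_product, Finset.mem_filter] at hp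
      exact hbad ⟨p.1, hp.1.2.1, hp.1.2.2, p.2, hξ.1, hξ.2⟩
    rw [Set.indicator_of_notMem hnot]; ring

/-! ### The tweak -/

open scoped Classical in
/-- The kept data: `f` cut to the vectors with no bad subsum ((ftilde) of §9 and the first display
of the proof of Theorem 6.3 (a)). [cite: FordMaynard2024PrimeSieves, §9 (ftilde)] -/
def tweakData {L : ℕ} (lo wd : Fin L → ℝ) (f : VecFn) : VecFn :=
  fun k ξ => if BadSubsum lo wd k ξ then 0 else f k ξ

open scoped Classical in
/-- **The tweaked function** `h`/`f̃`: the (6.3)-extension of `tweakData`, cut to the support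
`{ξᵢ ≥ η, |ξ| = 1}` of the class `𝔉*_η(γ)` ("Complete the definition of `f̃` by applying (fsl)").
[cite: FordMaynard2024PrimeSieves, §9 (proof of Theorem 9.1) and §6.2 (the tweak h)] -/
def tweak (γ η : ℝ) {L : ℕ} (lo wd : Fin L → ℝ) (f : VecFn) : VecFn :=
  fun k ξ => if (∀ i, η ≤ ξ i) ∧ ∑ i, ξ i = 1 then fragOp γ η (tweakData lo wd f) k ξ else 0

section Properties

variable {γ η : ℝ} {L : ℕ} {lo wd : Fin L → ℝ} {f : VecFn}

/-- `tweakData = f − badCut f`. [folklore] -/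
theorem tweakData_eq_sub (lo wd : Fin L → ℝ) (f : VecFn) (k : ℕ) (ξ : Fin k → ℝ) :
    tweakData lo wd f k ξ = f k ξ - badCut lo wd f k ξ := by
  classical
  unfold tweakData badCut
  split_ifs <;> ring

/-- `tweakData` is symmetric for `f ∈ 𝒮`. [folklore] -/
theorem isSymmetric_tweakData (hs : f.IsSymmetric) : (tweakData lo wd f).IsSymmetric := by
  classical
  intro k σ ξ
  unfold tweakData
  rw [badSubsum_comp_perm, hs k σ ξ]

/-- **`tweak ∈ 𝒮`.** [cite: FordMaynard2024PrimeSieves, Definition 6.1] -/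
theorem isSymmetric_tweak (hs : f.IsSymmetric) : (tweak γ η lo wd f).IsSymmetric := by
  classical
  intro k σ ξ
  unfold tweak
  have h1 : (∀ i, η ≤ (ξ ∘ σ) i) ↔ ∀ i, η ≤ ξ i :=
    ⟨fun h i => by simpa using h (σ.symm i), fun h i => h (σ i)⟩
  have h2 : ∑ i, (ξ ∘ σ) i = ∑ i, ξ i := Equiv.sum_comp σ ξ
  simp only [h1, h2]
  split_ifs
  · exact fragOp_comp_perm (isSymmetric_tweakData hs) σ ξ
  · rfl

/-- **Support of `tweak`.** [cite: FordMaynard2024PrimeSieves, Definition 6.2 (a)] -/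
theorem tweak_support {k : ℕ} {ξ : Fin k → ℝ} (h : tweak γ η lo wd f k ξ ≠ 0) :
    (∀ i, η ≤ ξ i) ∧ ∑ i, ξ i = 1 := by
  classical
  unfold tweak at h
  split_ifs at h with hc
  · exact hc
  · exact absurd rfl h

/-- `tweak` vanishes on the empty vector. [folklore] -/
theorem tweak_zero (ξ : Fin 0 → ℝ) : tweak γ η lo wd f 0 ξ = 0 := by
  by_contra h
  have := (tweak_support h).2
  simp at this

/-- `tweak` vanishes in dimensions `k > 1/η` (`η > 0`). [cite: FordMaynard2024PrimeSieves, §6 (remark after Definition 6.2)] -/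
theorem tweak_eq_zero_of_lt (hη : 0 < η) {k : ℕ} (hk : 1 / η < k) (ξ : Fin k → ℝ) :
    tweak γ η lo wd f k ξ = 0 := by
  by_contra h
  obtain ⟨hge, hsum⟩ := tweak_support h
  have hle : (k : ℝ) * η ≤ ∑ i, ξ i := by
    calc (k : ℝ) * η = ∑ _i : Fin k, η := by simp
      _ ≤ ∑ i, ξ i := Finset.sum_le_sum fun i _ => hge i
  rw [hsum] at hle
  have : (k : ℝ) ≤ 1 / η := by rwa [le_div_iff₀ hη]
  linarith

/-- **`tweak` vanishes at vectors with a bad subsum**: a bad nonempty proper subsum of `ξ` is a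
bad subsum of every fragmentation of `ξ`, where `tweakData` vanishes.
[cite: FordMaynard2024PrimeSieves, §6.2 ("h(β,α) = 0") and §9 ("If ξ ∉ 𝒟_{r,η}(P) … then clearly f̃(ξ) = 0")] -/
theorem tweak_eq_zero_of_badSubsum {k : ℕ} {ξ : Fin k → ℝ} (hbad : BadSubsum lo wd k ξ) :
    tweak γ η lo wd f k ξ = 0 := by
  classical
  by_contra h
  unfold tweak at h
  split_ifs at h with hc
  · obtain ⟨kv, U, hkv, hcond, hne⟩ := exists_of_fragOp_ne_zero h
    have hcoag := isCoagulationOf_concatBlocks (fun j => (hkv j).1) ξ (fun j => rowOf U j)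
    have hbad' := hcoag.badSubsum (lo := lo) (wd := wd) hbad
    apply hne
    unfold tweakData
    rw [if_pos hbad']
  · exact h rfl

/-! ### Regularity -/

/-- `tweakData` is piecewise Lipschitz in each dimension. [cite: FordMaynard2024PrimeSieves, §9 ("𝒟_{k,η}(P) is a finite union of convex polytopes")] -/
theorem isPiecewiseLipschitz_tweakData (hpl : ∀ k, IsPiecewiseLipschitz (f k)) (k : ℕ) :
    IsPiecewiseLipschitz (tweakData lo wd f k) := by
  classical
  have h := (hpl k).isPiecewiseLipschitz'.mul_polyLip (polyLip_notBad_indicator lo wd k)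
  have heq : (fun x => f k x * (if BadSubsum lo wd k x then (0 : ℝ) else 1)) = tweakData lo wd f k := by
    funext x; unfold tweakData; split_ifs <;> simp
  rw [heq] at h
  exact h.isPiecewiseLipschitz

/-- **`tweak` is piecewise Lipschitz in each dimension** (`0 < γ < 1`, `0 < η`).
[cite: FordMaynard2024PrimeSieves, §9 ("Then f̃ ∈ 𝔉_η(P)")] -/
theorem isPiecewiseLipschitz_tweak (hγ0 : 0 < γ) (hγ1 : γ < 1) (hη : 0 < η)
    (hpl : ∀ k, IsPiecewiseLipschitz (f k)) (k : ℕ) : IsPiecewiseLipschitz (tweak γ η lo wd f k) := by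
  classical
  have hfrag : IsPiecewiseLipschitz (fragOp γ η (tweakData lo wd f) k) :=
    FordMaynardFragmentationPiecewiseLipschitz_holds γ η hγ0 hγ1 hη _ (isPiecewiseLipschitz_tweakData hpl) k
  -- the support cut-off is the indicator of a polyhedral set
  have hS : IsPolyhedral {ξ : Fin k → ℝ | (∀ i, η ≤ ξ i) ∧ ∑ i, ξ i = 1} := by
    have h1 : IsPolyhedral {ξ : Fin k → ℝ | ∀ i, η ≤ ξ i} :=
      IsPolyhedral.setOf_forall fun i => by
        simpa using isPolyhedral_ge (LinearMap.proj (R := ℝ) (φ := fun _ : Fin k => ℝ) i) η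
    set φ : (Fin k → ℝ) →ₗ[ℝ] ℝ := ∑ t, LinearMap.proj t with hφ
    have hφapp : ∀ ξ : Fin k → ℝ, φ ξ = ∑ t, ξ t := fun ξ => by rw [hφ, LinearMap.sum_apply]; rfl
    have h2 : IsPolyhedral {ξ : Fin k → ℝ | ∑ i, ξ i = 1} := by
      have := (isPolyhedral_le φ 1).inter (isPolyhedral_ge φ 1)
      convert this using 1
      ext ξ; simp only [Set.mem_setOf_eq, Set.mem_inter_iff, hφapp]; constructor
      · intro h; exact ⟨h.le, h.ge⟩
      · intro h; exact le_antisymm h.1 h.2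
    convert h1.inter h2 using 1
    ext ξ; simp
  have h := hfrag.isPiecewiseLipschitz'.mul_polyLip (PolyLip.indicator_one hS)
  have heq : (fun x => fragOp γ η (tweakData lo wd f) k x *
      ({ξ : Fin k → ℝ | (∀ i, η ≤ ξ i) ∧ ∑ i, ξ i = 1}.indicator (fun _ => (1 : ℝ)) x)) = tweak γ η lo wd f k := by
    funext x
    unfold tweak
    by_cases hx : (∀ i, η ≤ x i) ∧ ∑ i, x i = 1
    · rw [if_pos hx, Set.indicator_of_mem (show x ∈ {ξ : Fin k → ℝ | (∀ i, η ≤ ξ i) ∧ ∑ i, ξ i = 1} from hx), mul_one]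
    · rw [if_neg hx, Set.indicator_of_notMem (show x ∉ {ξ : Fin k → ℝ | (∀ i, η ≤ ξ i) ∧ ∑ i, ξ i = 1} from hx), mul_zero]
  rw [heq] at h
  exact h.isPiecewiseLipschitz

/-- A uniform bound for `tweak` over all dimensions (`0 < γ < 1`, `0 < η`). [folklore] -/
theorem exists_bound_tweak (hγ0 : 0 < γ) (hγ1 : γ < 1) (hη : 0 < η) (hpl : ∀ k, IsPiecewiseLipschitz (f k)) :
    ∃ Hb : ℝ, 0 ≤ Hb ∧ ∀ (k : ℕ) (ξ : Fin k → ℝ), |tweak γ η lo wd f k ξ| ≤ Hb := by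
  classical
  have hk : ∀ k, ∃ M, 0 ≤ M ∧ ∀ ξ, |tweak γ η lo wd f k ξ| ≤ M := fun k =>
    (isPiecewiseLipschitz_tweak hγ0 hγ1 hη hpl k).exists_bound
  choose M hM0 hM using hk
  refine ⟨∑ k ∈ Finset.range (⌊1 / η⌋₊ + 1), M k, Finset.sum_nonneg fun k _ => hM0 k, fun k ξ => ?_⟩
  by_cases hkK : k ≤ ⌊1 / η⌋₊
  · exact (hM k ξ).trans (Finset.single_le_sum (fun k _ => hM0 k) (Finset.mem_range.2 (Nat.lt_succ_of_le hkK)))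
  · rw [tweak_eq_zero_of_lt hη ((Nat.lt_of_floor_lt (not_le.1 hkK))) ξ, abs_zero]
    exact Finset.sum_nonneg fun k _ => hM0 k

/-! ### The fragmentation relation and (TypeI-f) -/

/-- **`tweak` satisfies the fragmentation relation** (by construction: `fragOp` only reads values
at vectors with all entries in `[η, 1 − γ)`, where `tweak = tweakData`; `f` vanishes off
`|ξ| = 1`). [cite: FordMaynard2024PrimeSieves, Theorem 6.4 and the remark following it] -/
theorem fragRel_tweak (hη : 0 < η) (hη1 : η ≤ 1)
    (hsupp : ∀ (k : ℕ) (ξ : Fin k → ℝ), f k ξ ≠ 0 → (∀ i, η ≤ ξ i) ∧ ∑ i, ξ i = 1) :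
    FragRel γ η (tweak γ η lo wd f) := by
  classical
  intro m ξ hξ hsum
  have hagree : fragOp γ η (tweak γ η lo wd f) = fragOp γ η (tweakData lo wd f) := by
    refine fragOp_congr fun n w hw => ?_
    unfold tweak
    by_cases hc : (∀ i, η ≤ w i) ∧ ∑ i, w i = 1
    · rw [if_pos hc, fragOp_apply_of_small hη hη1 _ (fun t => (hw t).1) (fun t => (hw t).2)]
    · rw [if_neg hc]
      unfold tweakData
      split_ifs
      · rfl
      · by_contra hne
        exact hc (hsupp n w (Ne.symm hne))
  show tweak γ η lo wd f m ξ = fragOp γ η (tweak γ η lo wd f) m ξ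
  rw [hagree]
  unfold tweak
  rw [if_pos ⟨hξ, hsum⟩]

/-- **`tweak` satisfies (TypeI-f) with parameter `γ`** (Theorem 6.4, converse direction).
[cite: FordMaynard2024PrimeSieves, Theorem 6.4 ("By Theorem 6.4, (TypeI-f) holds for h")] -/
theorem typeIIdentity_tweak (hγ0 : 0 < γ) (hγ1 : γ < 1) (hη : 0 < η) (hη1 : η ≤ 1) (hs : f.IsSymmetric)
    (hpl : ∀ k, IsPiecewiseLipschitz (f k))
    (hsupp : ∀ (k : ℕ) (ξ : Fin k → ℝ), f k ξ ≠ 0 → (∀ i, η ≤ ξ i) ∧ ∑ i, ξ i = 1) :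
    TypeIIdentity γ (tweak γ η lo wd f) := by
  obtain ⟨Hb, -, hHb⟩ := exists_bound_tweak (lo := lo) (wd := wd) hγ0 hγ1 hη hpl
  exact typeI_of_fragRel hη hγ1 (isSymmetric_tweak hs)
    (fun k => (isPiecewiseLipschitz_tweak hγ0 hγ1 hη hpl k).measurable) hHb
    (fun k ξ h => tweak_support h) (fragRel_tweak hη hη1 hsupp)

/-! ### Closeness to `f` at good vectors -/

/-- **(f-ftilde)/(fh1), quantitative**: for `f ∈ 𝔉*_η(γ)` bounded by `F` and a good vector `ξ`
(entries `≥ η`, `|ξ| = 1`, no bad subsum),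
`|tweak(ξ) − f(ξ)| ≤ N^m (N(2^N)^N/η^N)^m F · 2^{mN} · 2(1+m)^{mN−1} ∑_l w_l`, `N = ⌊1/η⌋`.
[cite: FordMaynard2024PrimeSieves, §9 (f-ftilde) and §6.2 (fh1)] -/
theorem abs_tweak_sub_le (hf : MemTypeIStar η γ f) (hη : 0 < η) (hη1 : η ≤ 1) (hγ1 : γ < 1)
    {F : ℝ} (hF : ∀ n v, |f n v| ≤ F) (hwd : ∀ l, 0 ≤ wd l) {m : ℕ} {ξ : Fin m → ℝ}
    (hξ : ∀ i, η ≤ ξ i) (hsum : ∑ i, ξ i = 1) (hgood : ¬ BadSubsum lo wd m ξ) :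
    |tweak γ η lo wd f m ξ - f m ξ| ≤
      (maxBlock η : ℝ) ^ m * ((maxBlock η * (2 ^ maxBlock η) ^ maxBlock η / η ^ maxBlock η) ^ m * F) *
        ((2 : ℝ) ^ (m * maxBlock η) * (2 * (1 + m) ^ (m * maxBlock η - 1) * ∑ l, wd l)) := by
  classical
  have hfm : ∀ n, Measurable (f n) := fun n => (hf.piecewiseLipschitz n).measurable
  -- `tweak ξ = fragOp tweakData ξ`, `f ξ = fragOp f ξ`
  have h1 : tweak γ η lo wd f m ξ = fragOp γ η (tweakData lo wd f) m ξ := by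
    unfold tweak; rw [if_pos ⟨hξ, hsum⟩]
  have h2 : f m ξ = fragOp γ η f m ξ := hf.fragRel hη hγ1 m ξ hξ hsum
  -- `fragOp tweakData = fragOp f − fragOp (badCut f)`
  have h3 : fragOp γ η (tweakData lo wd f) m ξ = fragOp γ η f m ξ - fragOp γ η (badCut lo wd f) m ξ := by
    have heq : tweakData lo wd f = fun n w => f n w - badCut lo wd f n w := by
      funext n w; exact tweakData_eq_sub lo wd f n w
    rw [heq]
    exact fragOp_sub hη hη1 hfm (measurable_badCut lo wd hfm) hF (abs_badCut_le lo wd hF) m ξ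
  rw [h1, h3, ← h2, sub_sub_cancel_left, abs_neg]
  have hξ01 : ∀ j, 0 ≤ ξ j ∧ ξ j ≤ 1 := fun j => by
    refine ⟨hη.le.trans (hξ j), ?_⟩
    rw [← hsum]
    exact Finset.single_le_sum (fun i _ => hη.le.trans (hξ i)) (Finset.mem_univ j)
  exact abs_fragOp_badCut_le hη hη1 hF lo wd hwd ξ hξ01 hgood

end Properties

end Literature.NumberTheory.Sieve.FordMaynard
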